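import Mathlib
import HarnessLib
import Summits.HubbardSuperconductivity.HubbardSuperconductivity.Theorems.KLProgrammeKLRegimeEngineE4ScaleDoor

/-!
# (E4)ₙ door — the admissible-constant packaging PARAMETRIC IN THE ENGINE PACKAGE `(G, Q)` (survives every package raise)

Cell gate-hubbard-kl, seat hubbard-kl-k3c3-p2 (g6); companion of `…EngineE4ScaleDoor` (p518391) for plan g16's (R25) (KL STATUS 2026-08-27 09:50:22Z): the next
registration v5 of 20236 re-keys every stub from `(klEngGeo5, klEngQ5 P R)` to the RAISED package `(klEngGeo6, klEngQ6 P R)` (and later raises are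
possible), while `…E4ScaleDoor` §5 (`E4ScaleAt`, `klE4Tn`, …) is keyed to the v3-α binders at `(klEngGeo5, klEngQ5)` on the HYPOTHESIS side (`HistP` at the
package — not monotone under a raise).  Here the same packaging with the package as PARAMETERS `G : GeoConsts`, `Qf : SplitConsts → RenConsts → EngConsts`
(the thresholds `klEngC₃3 / klEngU₀4 / klEngL₃ / klEngM₃` are not raised by (R25) and stay literal):

* `E4ScaleAtPkg G Qf E` — under the stub-(c) binders AT `(G, Qf P R)`, every first space-time moment of the scale-`n` sectorised quartic kernel is `≤ E·Klam·|U|·4ⁿ`;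
* `E4ScaleAtPkg.mono`, the closed term `klE4TnPkg G Qf`, `klE4TnPkg_nonneg`, `e4ScaleAtPkg_klE4TnPkg`;
* consumer **`engineFirstMoments_of_e4ScaleAtPkg`** (`E ≤ G'.cE4`, `0 ≤ (Qf P R).cE4` ⇒ `EngineFirstMoments L M G' P (Qf P R) … n` under the binders at `(G, Qf)`; take
  `G' := G` for the stub), producer `e4ScaleAtPkg_of_wtPinnedSum` (from the package-free weighted pinned sums of `…E4ScaleDoor` §4);
* `e4ScaleAt_iff_pkg` : `E4ScaleAt E ↔ E4ScaleAtPkg klEngGeo5 klEngQ5 E` (the landed §5 is the instance at today's package).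
At v5: `E4ScaleAtPkg klEngGeo6 klEngQ6`.  Definitions + bookkeeping only; no analysis; nothing about superconductivity is asserted.
-/

noncomputable section

namespace Summit.HubbardSuperconductivity.HubbardSuperconductivity.Theorems.EngineV8

set_option linter.dupNamespace false -- summit = problem name (single-conjunct summit), D-0017

open Real Finset Literature.MathematicalPhysics.QuantumLattice Literature.Probability.LatticeModels
open Summit.HubbardSuperconductivity.HubbardSuperconductivity.Theorems.KLRegimeSplit
open Summit.HubbardSuperconductivity.HubbardSuperconductivity.Theorems.KLProgrammeLegKernels
open Summit.HubbardSuperconductivity.HubbardSuperconductivity.Theorems.DispersionFlow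

/-- **`E4ScaleAtPkg G Qf E`** — `E` is an admissible (E4)ₙ constant at the engine package `(G, Qf)`: under the binders of stub (c) `stub_engine_step_values` read
at `(G, Qf P R)` (history `HistP klPredsV16 … G P (Qf P R) …`, (E1-v4)/(E1-F) at `Qf P R`; thresholds `klEngC₃3 / klEngU₀4 / klEngL₃ / klEngM₃` literal), every
first space-time moment of the scale-`n` sectorised quartic kernel is `≤ E · P.Klam · |U| · 4ⁿ`. -/
def E4ScaleAtPkg (G : GeoConsts) (Qf : SplitConsts → RenConsts → EngConsts) (E : ℝ) : Prop :=
  ∀ (P : SplitConsts) (R : RenConsts) (c : ℝ), P.WF → R.WF2 → 0 < c → c ≤ klEngC₃3 P R → ∀ μ ∈ klWindowC, ∀ U : ℝ, 0 < U →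
    U ≤ klEngU₀4 P R c → ∀ β : ℝ, klBetaMin ≤ β → β ≤ Real.exp (c / U ^ 2) → ∀ K : TrigPolyC4v, FrameOK R U (nScales β) μ K →
    ∀ (L M : ℕ) [NeZero L] [NeZero M], klEngL₃ β U ≤ L → klEngM₃ β U L ≤ M → ∀ n : ℕ, 1 ≤ n → n ≤ nScales β + 1 →
    IsKLRegime U c (-(n : ℤ)) → HistP klPredsV16 L M G P (Qf P R) R β U μ K n →
    KernelNormsV4 L M P (Qf P R) β U μ K n → (∀ j ≤ n, KernelNormsLevels L M P (Qf P R) β U μ K j) →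
    ∀ (Ω : Fin 4 → SectorLeg (sectorCount n)) (i k : Fin 4),
      imagTimeWeight β M ^ 3 *
          ∑ x : Fin 3 → SpaceTimeIdx L M,
            KLRegimeSplit.spaceTimeDist L M β (Matrix.vecCons (0 : SpaceTimeIdx L M) x i) (Matrix.vecCons (0 : SpaceTimeIdx L M) x k) *
              ‖klAnisoLegKernel L M β U μ K klE0 n 4 Ω (Matrix.vecCons (0 : SpaceTimeIdx L M) x)‖ ≤
        E * P.Klam * |U| * (4 : ℝ) ^ n

/-- The landed `E4ScaleAt` is the instance at today's package `(klEngGeo5, klEngQ5)`. -/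
theorem e4ScaleAt_iff_pkg (E : ℝ) : E4ScaleAt E ↔ E4ScaleAtPkg klEngGeo5 klEngQ5 E := Iff.rfl

variable {G : GeoConsts} {Qf : SplitConsts → RenConsts → EngConsts}

/-- A larger constant is still admissible (`1 ≤ P.Klam` from `P.WF`). -/
theorem E4ScaleAtPkg.mono {E E' : ℝ} (h : E4ScaleAtPkg G Qf E) (hEE' : E ≤ E') : E4ScaleAtPkg G Qf E' := by
  intro P R c hP hR hc hc₃ μ hμ U hU hU₀ β hβ hβc K hK L M _ _ hL hM n hn hnle hreg hhist hE1 hlev Ω i k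
  refine (h P R c hP hR hc hc₃ μ hμ U hU hU₀ β hβ hβc K hK L M hL hM n hn hnle hreg hhist hE1 hlev Ω i k).trans ?_
  have hK0 : 0 ≤ P.Klam := zero_le_one.trans hP.1
  have : 0 ≤ P.Klam * |U| * (4 : ℝ) ^ n := by positivity
  nlinarith

variable (G Qf)

open Classical in
/-- **`klE4TnPkg G Qf`** — THE (E4)ₙ constant at the package `(G, Qf)`: a nonnegative admissible constant when one exists, `0` otherwise (closed term). -/
def klE4TnPkg : ℝ := if h : (∃ E : ℝ, 0 ≤ E ∧ E4ScaleAtPkg G Qf E) then Classical.choose h else 0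

/-- `0 ≤ klE4TnPkg G Qf`. -/
theorem klE4TnPkg_nonneg : 0 ≤ klE4TnPkg G Qf := by
  classical
  unfold klE4TnPkg
  split_ifs with h
  · exact (Classical.choose_spec h).1
  · exact le_rfl

variable {G Qf}

/-- **`klE4TnPkg G Qf` is admissible as soon as any nonnegative constant is.** -/
theorem e4ScaleAtPkg_klE4TnPkg {E : ℝ} (hE0 : 0 ≤ E) (hE : E4ScaleAtPkg G Qf E) : E4ScaleAtPkg G Qf (klE4TnPkg G Qf) := by
  classical
  have h : ∃ E : ℝ, 0 ≤ E ∧ E4ScaleAtPkg G Qf E := ⟨E, hE0, hE⟩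
  have : klE4TnPkg G Qf = Classical.choose h := by unfold klE4TnPkg; exact dif_pos h
  rw [this]
  exact (Classical.choose_spec h).2

/-- **Consumer form at the package**: from `E4ScaleAtPkg G Qf E`, any `G'` with `E ≤ G'.cE4`, and `0 ≤ (Qf P R).cE4`, under the stub-(c) binders at `(G, Qf P R)`,
`EngineFirstMoments L M G' P (Qf P R) β U μ K n` (take `G' := G` for the registered stub; `G' :=` a raise for a later package). -/
theorem engineFirstMoments_of_e4ScaleAtPkg {E : ℝ} (hE : E4ScaleAtPkg G Qf E) (G' : GeoConsts) (hcE4 : E ≤ G'.cE4)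
    (P : SplitConsts) (R : RenConsts) (hQ0 : 0 ≤ (Qf P R).cE4) (c : ℝ) (hP : P.WF) (hR : R.WF2) (hc : 0 < c) (hc₃ : c ≤ klEngC₃3 P R)
    (μ : ℝ) (hμ : μ ∈ klWindowC) (U : ℝ) (hU : 0 < U) (hU₀ : U ≤ klEngU₀4 P R c) (β : ℝ) (hβ : klBetaMin ≤ β)
    (hβc : β ≤ Real.exp (c / U ^ 2)) (K : TrigPolyC4v) (hK : FrameOK R U (nScales β) μ K) (L M : ℕ) [NeZero L] [NeZero M]
    (hL : klEngL₃ β U ≤ L) (hM : klEngM₃ β U L ≤ M) (n : ℕ) (hn : 1 ≤ n) (hnle : n ≤ nScales β + 1) (hreg : IsKLRegime U c (-(n : ℤ)))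
    (hhist : HistP klPredsV16 L M G P (Qf P R) R β U μ K n) (hE1 : KernelNormsV4 L M P (Qf P R) β U μ K n)
    (hlev : ∀ j ≤ n, KernelNormsLevels L M P (Qf P R) β U μ K j) :
    EngineFirstMoments L M G' P (Qf P R) β U μ K n := by
  intro Ω i k
  refine (hE P R c hP hR hc hc₃ μ hμ U hU hU₀ β hβ hβc K hK L M hL hM n hn hnle hreg hhist hE1 hlev Ω i k).trans ?_
  have hK0 : 0 ≤ P.Klam := zero_le_one.trans hP.1
  have h1 : 0 ≤ P.Klam * |U| * (4 : ℝ) ^ n := by positivity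
  have h2 : E ≤ G'.cE4 + (Qf P R).cE4 * |U| := hcE4.trans (le_add_of_nonneg_right (mul_nonneg hQ0 (abs_nonneg U)))
  calc E * P.Klam * |U| * (4 : ℝ) ^ n = E * (P.Klam * |U| * (4 : ℝ) ^ n) := by ring
    _ ≤ (G'.cE4 + (Qf P R).cE4 * |U|) * (P.Klam * |U| * (4 : ℝ) ^ n) := mul_le_mul_of_nonneg_right h2 h1
    _ = _ := by ring

/-- **Producer form at the package**: a scale-uniform bound of the degree-`4` weighted pinned sums UNDER THE BINDERS AT `(G, Qf)`,
`klWtPinnedSum … n 4 0 (0, ℓ₀) ≤ klE0 · E · P.Klam · |U|`, makes `E` admissible at `(G, Qf)`. -/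
theorem e4ScaleAtPkg_of_wtPinnedSum {E : ℝ}
    (h : ∀ (P : SplitConsts) (R : RenConsts) (c : ℝ), P.WF → R.WF2 → 0 < c → c ≤ klEngC₃3 P R → ∀ μ ∈ klWindowC, ∀ U : ℝ, 0 < U →
      U ≤ klEngU₀4 P R c → ∀ β : ℝ, klBetaMin ≤ β → β ≤ Real.exp (c / U ^ 2) → ∀ K : TrigPolyC4v, FrameOK R U (nScales β) μ K →
      ∀ (L M : ℕ) [NeZero L] [NeZero M], klEngL₃ β U ≤ L → klEngM₃ β U L ≤ M → ∀ n : ℕ, 1 ≤ n → n ≤ nScales β + 1 →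
      IsKLRegime U c (-(n : ℤ)) → HistP klPredsV16 L M G P (Qf P R) R β U μ K n →
      KernelNormsV4 L M P (Qf P R) β U μ K n → (∀ j ≤ n, KernelNormsLevels L M P (Qf P R) β U μ K j) →
      ∀ ℓ₀ : SectorLeg (sectorCount n), klWtPinnedSum L M β U μ K n 4 0 ((0 : SpaceTimeIdx L M), ℓ₀) ≤ klE0 * (E * P.Klam * |U|)) :
    E4ScaleAtPkg G Qf E := by
  intro P R c hP hR hc hc₃ μ hμ U hU hU₀ β hβ hβc K hK L M _ _ hL hM n hn hnle hreg hhist hE1 hlev Ω i k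
  have hβ0 : 0 < β := lt_of_lt_of_le (by norm_num [klBetaMin]) hβ
  have hΛ := klth_klScale_pos n
  have hmain := (klScale_mul_firstMoment_le_klWtPinnedSum (L := L) (M := M) hβ0.le U μ K n Ω i k).trans
    (h P R c hP hR hc hc₃ μ hμ U hU hU₀ β hβ hβc K hK L M hL hM n hn hnle hreg hhist hE1 hlev (Ω 0))
  have e := klScale_klE0_mul_four_pow n
  set B : ℝ := E * P.Klam * |U| with hB
  have h2 : klE0 * B / klScale klE0 n = B * (4 : ℝ) ^ n := by
    rw [show klE0 * B / klScale klE0 n = klScale klE0 n * (4 : ℝ) ^ n * B / klScale klE0 n by rw [e]]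
    field_simp
  calc _ = klScale klE0 n * (imagTimeWeight β M ^ 3 *
          ∑ x : Fin 3 → SpaceTimeIdx L M,
            KLRegimeSplit.spaceTimeDist L M β (Matrix.vecCons (0 : SpaceTimeIdx L M) x i) (Matrix.vecCons (0 : SpaceTimeIdx L M) x k) *
              ‖klAnisoLegKernel L M β U μ K klE0 n 4 Ω (Matrix.vecCons (0 : SpaceTimeIdx L M) x)‖) / klScale klE0 n :=
        (mul_div_cancel_left₀ _ hΛ.ne').symm
    _ ≤ klE0 * B / klScale klE0 n := div_le_div_of_nonneg_right hmain hΛ.le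
    _ = B * (4 : ℝ) ^ n := h2

end Summit.HubbardSuperconductivity.HubbardSuperconductivity.Theorems.EngineV8

end
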